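/-
Copyright (c) 2026 the pub-hodgecm-mathlib formalisation cell (harness21).  Prover seat hodgecm-mathlib-K2Liu-p14 (g5) (cross-line VALVE 16 (n) hand at section S6,
dealer R90-C14-plan (g2)), card GF1 «G-SIDE FIX DATA», FILE 2a = the GENERIC coset → tree plumbing on `X₃` (cut 2026-09-05T02:49Z: 2a this file ∕ 2b the per-literal
Flicker values, R90-C14-p10 (g2)).  THEOREMS ONLY (no `def`, no `instance`, no notation, no named-fact hypothesis, no `sorry`); lane `--supports stmt-HodgeConjecture-24833
--as helper` (count-neutral helper).
-/
import Summits.HodgeConjecture.HodgeConjecture.Theorems.R90S6TreeFixDataFirstShell          -- ★ GF1 FILE 1 `ncard_displaced_two_inter_type_add_card_fixed_eq` (generic first shell)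
import Summits.HodgeConjecture.HodgeConjecture.Theorems.R90S6FixedCosetsVertexDictionary    -- ★ DICT0 (D0.1) `natCard_fixedBy_quotient_glInt_eq_ncard_selfDual_fixed`, (D0.2) `…_conj_glInt_eq_ncard_typeTwo_fixed`
import Summits.HodgeConjecture.HodgeConjecture.Theorems.R90S6GSideEllipticValueClosed       -- ★ G3-NUMBERS §1 `ncard_selfDual_displaced_eq_pow_mul_firstShell_three` (+ ★ A1, ★ W8-f, ★ V4 valency)
import Literature.NumberTheory.Automorphic.UnitaryLatticeTreeEulerRelation                   -- ★ `exists_latticeGraphIso_apply_eq_self_three` (a fixed vertex); brings ★ `UnitaryLatticeTreeFixedCosetFlags` (A), (B)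
import HarnessLib

/-!
# R90 · S6 — card GF1 FILE 2a `R90S6TreeFixDataCosetShellsU3`: THE FIRST DISPLACEMENT SHELLS OF `X₃` FROM THE TWO FIXED-COSET COUNTS
# `N′_sp + (V_hyp + V_sp) = (q³+1)·V_hyp + 1`, `N′_hyp + (V_hyp + V_sp) = (q+1)·V_sp + 1`

Cell `hodgecm-mathlib`, crux H413 (`stmt-HodgeConjecture-24833`), route `HCCMUnconditional`; programme R90-TF, section S6 (base `R90-C14`, dealer R90-C14-plan (g2)),
seat K2Liu-p14 (g5); card **GF1** «G-side fix data of the four Flicker literals» (row E1.3.5.2.6), FILE 2a = the literal-free, regime-free COSET → TREE plumbing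
(FILE 1 ★ `R90S6TreeFixDataFirstShell` is the pure graph theory; FILE 2b `R90S6TreeFixDataFlickerU3` (R90-C14-p10 (g2)) plugs the per-literal values).

THE MATHEMATICS (Kottwitz 1988 §2; Serre, *Trees* I.6, II.1; Tits 1979 §2.4).  `hd : UnramifiedLocalConjDatum σ ϖ` an unramified datum on the non-archimedean field `K`,
`U = U(σ, J₀)(K)` the quasi-split unitary group of `J₀ = antidiag(1,1,1)`, `X₃` its Bruhat–Tits tree (★ `latticeGraph σ ϖ J₀`, a `(q³+1, q+1)`-bi-regular tree, ★
`isTree_latticeGraph_three_of_unramified`, ★ V4 `ncard_neighborSet_eq_typeFun`), `K₀ = U ∩ GL₃(𝒪)` the stabiliser of the hyperspecial root `L₀ = 𝒪³`, `g₁ = diag(1,1,ϖ)` and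
`K₁ = U ∩ g₁GL₃(𝒪)g₁⁻¹` the stabiliser of the special vertex `g₁L₀`.  For `γ ∈ U` put `V_hyp := #Fix_γ(U ⧸ K₀)` and `V_sp := #Fix_γ(U ⧸ K₁)`.  By the dictionary ★ DICT0
(transitivity of `U` on the vertices of each type) these are the numbers of `γ`-fixed hyperspecial ∕ special VERTICES of `X₃`, so `#Fix_γ(X₃) = V_hyp + V_sp`; and by ★ GF1
FILE 1 (the fixed set is a finite subtree, bipartite for the type colouring, so `#E(Fix) + 1 = #Fix`) the first displacement shells are
`N′_sp := #{x : d(x, γx) = 2, x special} = (q³+1)·V_hyp − (V_hyp + V_sp − 1)` and `N′_hyp := #{x : d(x, γx) = 2, x hyperspecial} = (q+1)·V_sp − (V_hyp + V_sp − 1)`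
(stated additively in `ℕ`).  With ★ G3-NUMBERS §1 every hyperspecial displacement shell `S′_k = #{x hyperspecial : d(x, γx) = 2k}` (`k ≥ 1`) — the shells the orbital
integrals `O_γ(1_{K₀ t^k K₀})` count (★ A1) — follows: `S′_k = q^{2(k−1)}·N′_hyp` (`k` odd), `= q^{2k−3}·N′_sp` (`k ≥ 2` even).
* §1 plumbing (PUBLIC, shared with FILE 2b): the type split of a finite vertex set, the two filtered fixed-vertex counts as DICT0's right-hand sides, `#Fix_γ(X₃) = V_hyp + V_sp`,
  and the finiteness of `Fix_γ(X₃)` from the finiteness of the two fixed-coset sets (★ (A), (B) equivalences of `UnitaryLatticeTreeFixedCosetFlags`);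
* §2 the two heads in TREE letters (★ G3-NUMBERS currency `hu hfix c hc0 q hdeg`): `ncard_displaced_two_typeTwo_add_natCard_fixedBy_eq`, `ncard_displaced_two_selfDual_add_natCard_fixedBy_eq`;
* §3 **the assembly shell FILE 2b plugs** — COSET letters only (★ T2's residual ∕ finiteness binders VERBATIM + the two value letters `hV₀ hV₁`):
  `ncard_displaced_two_add_eq_of_natCard_fixedBy_eq`;
* §4 all hyperspecial shells from `(V_hyp, V_sp)`: `ncard_selfDual_displaced_add_eq_of_natCard_fixedBy_eq`.
HONEST LABEL: bookkeeping over ★ files; proves no printed global statement, discharges no citation; count-neutral helper until E1.3.5.2 ∕ E1.3.9 consume it.  HC_CM is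
proved only modulo the 7 printed citations (2 remaining named inputs: hLiu418 = stmt-HodgeConjecture-24832, h413 = stmt-HodgeConjecture-24833) until rung 0 closes.

## References
* [Kottwitz1988] R. E. Kottwitz, *Tamagawa numbers*, Ann. of Math. 127 (1988), §2 (fixed subtree of an elliptic element, `V − E = 1`).
* [Serre1980Trees] J.-P. Serre, *Trees* (1980), Ch. I §6.1, §6.4 Prop. 24; Ch. II §1.1 (the tree of a local field).
* [Tits1979] J. Tits, *Reductive groups over local fields*, Proc. Sympos. Pure Math. 33.1 (1979), §2.4, §3.3.3 (the `(q³+1, q+1)` tree of quasi-split `U(3)`).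
* [BruhatTits1972] F. Bruhat, J. Tits, *Groupes réductifs sur un corps local I*, Publ. Math. IHÉS 41 (1972), §10.
* [Rogawski1990] J. D. Rogawski, *Automorphic representations of unitary groups in three variables* (1990), §4.9 pp. 54–55, §12.3 p. 176.
-/

set_option autoImplicit false
-- the mandated namespace repeats the single-problem summit's segment (`HodgeConjecture.HodgeConjecture`)
set_option linter.dupNamespace false

open MulAction SimpleGraph Finset
open scoped Valued WithZero Matrix MatrixGroups
open Literature.NumberTheory.Automorphic Literature.NumberTheory.Automorphic.HermitianLattice Literature.NumberTheory.Automorphic.UnitaryGroup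
open Literature.NumberTheory.Automorphic.UnitaryLatticeTree Literature.NumberTheory.Automorphic.CartanUnique
open Literature.Combinatorics.SimpleGraph

namespace Summit.HodgeConjecture.HodgeConjecture.R90.S6

variable {K : Type*} [Field K] [Valued K ℤᵐ⁰] {σ : K →+* K} {ϖ : K}

/-! ## §1 Plumbing: the type split of the fixed vertices and the coset dictionary -/

/-- **Type split of a finite vertex set**: `#s = #{y ∈ s : c y = 0} + #{y ∈ s : c y = 1}` for any `c : V → Fin 2`. [cite: Serre1980Trees, I.2.3] -/
theorem card_toFinset_eq_card_filter_add {V : Type*} {s : Set V} (hs : s.Finite) (c : V → Fin 2) :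
    hs.toFinset.card = (hs.toFinset.filter (fun y => c y = 0)).card + (hs.toFinset.filter (fun y => c y = 1)).card := by
  rw [← Finset.card_filter_add_card_filter_not (s := hs.toFinset) (fun y => c y = 0)]
  congr 2
  exact Finset.filter_congr fun y _ => ⟨fun h => Fin.eq_one_of_ne_zero _ h, fun h h0 => by rw [h0] at h; exact absurd h (by decide)⟩

/-- For a type function `c` of `X₃` (`c v = 0 ↔ v` self-dual): `c v = 1 ↔ v` is of type two. [cite: BruhatTits1972, §10] [cite: Tits1979, §2.4] -/
theorem typeFun_eq_one_iff_isVertexLattice_two (hd : UnramifiedLocalConjDatum σ ϖ)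
    {c : {M : Submodule 𝒪[K] (Fin 3 → K) // IsVertex σ ϖ ((StdForm.antidiagonal 3).over K) M} → Fin 2}
    (hc0 : ∀ v, c v = 0 ↔ IsSelfDualLattice σ ϖ ((StdForm.antidiagonal 3).over K) v.1)
    (v : {M : Submodule 𝒪[K] (Fin 3 → K) // IsVertex σ ϖ ((StdForm.antidiagonal 3).over K) M}) :
    c v = 1 ↔ IsVertexLattice σ ϖ ((StdForm.antidiagonal 3).over K) 2 v.1 := by
  rw [typeFun_eq_one_iff hc0 v]
  exact ⟨isVertexLattice_two_of_not_isSelfDualLattice hd v, fun h2 => not_isSelfDualLattice_of_isVertexLattice_two hd h2⟩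

/-- **The fixed vertices of type `0`, counted**: `#{y ∈ Fix γ : c y = 0} = #{v : v self-dual ∧ γv = v}` (★ DICT0 (D0.1)'s right-hand side). [cite: Kottwitz1988, §2] -/
theorem card_filter_typeFun_eq_zero_eq_ncard (γ : ↥(unitaryGroupOfForm σ ((StdForm.antidiagonal 3).over K)))
    (hfix : {v : {M : Submodule 𝒪[K] (Fin 3 → K) // IsVertex σ ϖ ((StdForm.antidiagonal 3).over K) M} |
      latticeGraphIso σ ϖ ((StdForm.antidiagonal 3).over K) γ v = v}.Finite)
    (c : {M : Submodule 𝒪[K] (Fin 3 → K) // IsVertex σ ϖ ((StdForm.antidiagonal 3).over K) M} → Fin 2)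
    (hc0 : ∀ v, c v = 0 ↔ IsSelfDualLattice σ ϖ ((StdForm.antidiagonal 3).over K) v.1) :
    (hfix.toFinset.filter (fun y => c y = 0)).card =
      {v : {M : Submodule 𝒪[K] (Fin 3 → K) // IsVertex σ ϖ ((StdForm.antidiagonal 3).over K) M} |
        IsSelfDualLattice σ ϖ ((StdForm.antidiagonal 3).over K) v.1 ∧ latticeGraphIso σ ϖ ((StdForm.antidiagonal 3).over K) γ v = v}.ncard := by
  rw [← Set.ncard_coe_finset]
  congr 1
  ext v
  simp only [Finset.coe_filter, Set.Finite.mem_toFinset, Set.mem_setOf_eq]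
  rw [hc0 v]
  exact and_comm

/-- **The fixed vertices of type `1`, counted**: `#{y ∈ Fix γ : c y = 1} = #{v : v of type two ∧ γv = v}` (★ DICT0 (D0.2)'s right-hand side). [cite: Kottwitz1988, §2] -/
theorem card_filter_typeFun_eq_one_eq_ncard (hd : UnramifiedLocalConjDatum σ ϖ) (γ : ↥(unitaryGroupOfForm σ ((StdForm.antidiagonal 3).over K)))
    (hfix : {v : {M : Submodule 𝒪[K] (Fin 3 → K) // IsVertex σ ϖ ((StdForm.antidiagonal 3).over K) M} |
      latticeGraphIso σ ϖ ((StdForm.antidiagonal 3).over K) γ v = v}.Finite)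
    (c : {M : Submodule 𝒪[K] (Fin 3 → K) // IsVertex σ ϖ ((StdForm.antidiagonal 3).over K) M} → Fin 2)
    (hc0 : ∀ v, c v = 0 ↔ IsSelfDualLattice σ ϖ ((StdForm.antidiagonal 3).over K) v.1) :
    (hfix.toFinset.filter (fun y => c y = 1)).card =
      {v : {M : Submodule 𝒪[K] (Fin 3 → K) // IsVertex σ ϖ ((StdForm.antidiagonal 3).over K) M} |
        IsVertexLattice σ ϖ ((StdForm.antidiagonal 3).over K) 2 v.1 ∧ latticeGraphIso σ ϖ ((StdForm.antidiagonal 3).over K) γ v = v}.ncard := by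
  rw [← Set.ncard_coe_finset]
  congr 1
  ext v
  simp only [Finset.coe_filter, Set.Finite.mem_toFinset, Set.mem_setOf_eq]
  rw [typeFun_eq_one_iff_isVertexLattice_two hd hc0 v]
  exact and_comm

section Cosets

variable [ValuativeRel K] [(Valued.v : Valuation K ℤᵐ⁰).Compatible]

/-- **`#Fix_γ(X₃) = V_hyp + V_sp`**: the `γ`-fixed vertices of the tree are counted by the fixed cosets in `U ⧸ K₀` (hyperspecial) and `U ⧸ K₁` (special) — ★ DICT0
(D0.1) + (D0.2) through the type split. [cite: Kottwitz1988, §2] [cite: BruhatTits1972, §10] -/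
theorem card_toFinset_fixed_eq_natCard_fixedBy_add (hd : UnramifiedLocalConjDatum σ ϖ)
    (g₁ : GL (Fin 3) K) (hg₁ : (g₁ : Matrix (Fin 3) (Fin 3) K) = Matrix.diagonal ![(1 : K), 1, ϖ])
    (γ : ↥(unitaryGroupOfForm σ ((StdForm.antidiagonal 3).over K)))
    (hfix : {v : {M : Submodule 𝒪[K] (Fin 3 → K) // IsVertex σ ϖ ((StdForm.antidiagonal 3).over K) M} |
      latticeGraphIso σ ϖ ((StdForm.antidiagonal 3).over K) γ v = v}.Finite) :
    hfix.toFinset.card =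
      Nat.card (fixedBy (↥(unitaryGroupOfForm σ ((StdForm.antidiagonal 3).over K)) ⧸
          (glInt 3 K).subgroupOf (unitaryGroupOfForm σ ((StdForm.antidiagonal 3).over K))) γ) +
        Nat.card (fixedBy (↥(unitaryGroupOfForm σ ((StdForm.antidiagonal 3).over K)) ⧸
          ((glInt 3 K).map (MulAut.conj g₁).toMonoidHom).subgroupOf (unitaryGroupOfForm σ ((StdForm.antidiagonal 3).over K))) γ) := by
  classical
  obtain ⟨c, hc0⟩ := exists_typeFun (K := K) (σ := σ) (ϖ := ϖ)
  rw [card_toFinset_eq_card_filter_add hfix c, card_filter_typeFun_eq_zero_eq_ncard γ hfix c hc0, card_filter_typeFun_eq_one_eq_ncard hd γ hfix c hc0,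
    natCard_fixedBy_quotient_glInt_eq_ncard_selfDual_fixed hd γ, natCard_fixedBy_quotient_conj_glInt_eq_ncard_typeTwo_fixed hd g₁ hg₁ γ]

/-- **`Fix_γ(X₃)` is finite as soon as `Fix_γ(U ⧸ K₀)` and `Fix_γ(U ⧸ K₁)` are** — the fixed vertices are the fixed self-dual plus the fixed type-two vertices, in bijection
with the two fixed-coset sets by ★ (A) `exists_fixedBy_equiv_fixed_selfDual_rankN` and ★ (B) `exists_fixedBy_conj_equiv_fixed_type` (transitivity of `U` on each type:
★ `exists_unitary_mapGL_stdLattice_eq_of_isSelfDualLattice_of_trace`, ★ `forall_isVertexLattice_two_exists_mapGL_N₁_eq`). [cite: Kottwitz1988, §2] [cite: BruhatTits1972, §10] -/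
theorem finite_fixed_vertices_of_finite_fixedBy (hd : UnramifiedLocalConjDatum σ ϖ)
    (g₁ : GL (Fin 3) K) (hg₁ : (g₁ : Matrix (Fin 3) (Fin 3) K) = Matrix.diagonal ![(1 : K), 1, ϖ])
    (γ : ↥(unitaryGroupOfForm σ ((StdForm.antidiagonal 3).over K)))
    (hK₀fin : (fixedBy (↥(unitaryGroupOfForm σ ((StdForm.antidiagonal 3).over K)) ⧸
      (glInt 3 K).subgroupOf (unitaryGroupOfForm σ ((StdForm.antidiagonal 3).over K))) γ).Finite)
    (hK₁fin : (fixedBy (↥(unitaryGroupOfForm σ ((StdForm.antidiagonal 3).over K)) ⧸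
      ((glInt 3 K).map (MulAut.conj g₁).toMonoidHom).subgroupOf (unitaryGroupOfForm σ ((StdForm.antidiagonal 3).over K))) γ).Finite) :
    {v : {M : Submodule 𝒪[K] (Fin 3 → K) // IsVertex σ ϖ ((StdForm.antidiagonal 3).over K) M} |
      latticeGraphIso σ ϖ ((StdForm.antidiagonal 3).over K) γ v = v}.Finite := by
  classical
  have hϖ0 : ϖ ≠ 0 := uniformizer_ne_zero hd.vϖ
  have hϖ1 : Valued.v ϖ ≤ 1 := uniformizer_mem_integer hd.vϖ
  have hroot : IsSelfDualLattice σ ϖ ((StdForm.antidiagonal 3).over K) (stdLattice K 3) := isSelfDualLattice_stdLattice_three hd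
  -- the base special vertex `N₁ = g₁·L₀`
  have hN₁ : mapGL g₁ (stdLattice K 3) = latt (Matrix.diagonal ![(1 : K), 1, ϖ]) := by rw [← hg₁]; rfl
  have hg₁2 : IsVertexLattice σ ϖ ((StdForm.antidiagonal 3).over K) 2 (mapGL g₁ (stdLattice K 3)) := by
    rw [hN₁]; exact isVertexLattice_two_latt_diagonal_one_one hd.σϖ hϖ1 hϖ0
  -- the two transitivities, for the unramified datum
  have hA : ∀ M : Submodule (Valued.integer K) (Fin 3 → K), IsSelfDualLattice σ ϖ ((StdForm.antidiagonal 3).over K) M →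
      ∃ u : ↥(unitaryGroupOfForm σ ((StdForm.antidiagonal 3).over K)), mapGL (u : GL (Fin 3) K) (stdLattice K 3) = M := fun M hM =>
    exists_unitary_mapGL_stdLattice_eq_of_isSelfDualLattice_of_trace hd.σσ hd.vσ hd.vϖ hd.trace hM
  have hB : ∀ M : Submodule (Valued.integer K) (Fin 3 → K), IsVertexLattice σ ϖ ((StdForm.antidiagonal 3).over K) 2 M →
      ∃ u : ↥(unitaryGroupOfForm σ ((StdForm.antidiagonal 3).over K)), mapGL ((u : GL (Fin 3) K) * g₁) (stdLattice K 3) = M := by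
    intro M hM
    obtain ⟨u, hu⟩ := forall_isVertexLattice_two_exists_mapGL_N₁_eq hd M hM
    exact ⟨u, by rw [mapGL_mul, hN₁, hu]⟩
  obtain ⟨eA, -⟩ := exists_fixedBy_equiv_fixed_selfDual_rankN σ ϖ _ hroot hA γ
  obtain ⟨eB, -⟩ := exists_fixedBy_conj_equiv_fixed_type σ ϖ _ hg₁2 hB γ
  haveI := hK₀fin.to_subtype
  haveI := hK₁fin.to_subtype
  have hfinA : {v : {M : Submodule (Valued.integer K) (Fin 3 → K) // IsVertex σ ϖ ((StdForm.antidiagonal 3).over K) M} |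
      latticeGraphIso σ ϖ ((StdForm.antidiagonal 3).over K) γ v = v ∧ IsSelfDualLattice σ ϖ ((StdForm.antidiagonal 3).over K) v.1}.Finite :=
    Set.finite_coe_iff.1 (Finite.of_equiv _ eA)
  have hfinB : {v : {M : Submodule (Valued.integer K) (Fin 3 → K) // IsVertex σ ϖ ((StdForm.antidiagonal 3).over K) M} |
      latticeGraphIso σ ϖ ((StdForm.antidiagonal 3).over K) γ v = v ∧ IsVertexLattice σ ϖ ((StdForm.antidiagonal 3).over K) 2 v.1}.Finite :=
    Set.finite_coe_iff.1 (Finite.of_equiv _ eB)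
  refine (hfinA.union hfinB).subset fun v hv => ?_
  obtain ⟨d, hvd⟩ := v.2
  rcases type_eq_zero_or_two_of_isVertexLattice_three hd.vσ hd.vϖ v_det_antidiagonal_three hvd with rfl | rfl
  · exact Or.inl ⟨hv, hvd⟩
  · exact Or.inr ⟨hv, hvd⟩

/-! ## §2 The two first displacement shells against `(V_hyp, V_sp)` — tree-letter edition -/

/-- **`N′_sp + (V_hyp + V_sp) = (q³ + 1)·V_hyp + 1`** on `X₃`: for `γ ∈ U` fixing a vertex `u`, with finite fixed vertex set, a type function `c` and the
`(q³+1, q+1)`-bi-regularity `hdeg`, the number of TYPE-TWO (special) vertices displaced by `2` plus the number of fixed vertices is `(q³+1)` times the number of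
fixed hyperspecial vertices plus one — ★ GF1 FILE 1 at `(i, j) = (1, 0)`, `d = (q³+1, q+1)`, with ★ DICT0 (D0.1) and §1. [cite: Kottwitz1988, §2] [cite: Serre1980Trees, I.6.1, I.6.4]
[cite: Tits1979, §2.4] -/
theorem ncard_displaced_two_typeTwo_add_natCard_fixedBy_eq (hd : UnramifiedLocalConjDatum σ ϖ)
    (g₁ : GL (Fin 3) K) (hg₁ : (g₁ : Matrix (Fin 3) (Fin 3) K) = Matrix.diagonal ![(1 : K), 1, ϖ])
    (γ : ↥(unitaryGroupOfForm σ ((StdForm.antidiagonal 3).over K)))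
    {u : {M : Submodule 𝒪[K] (Fin 3 → K) // IsVertex σ ϖ ((StdForm.antidiagonal 3).over K) M}}
    (hu : latticeGraphIso σ ϖ ((StdForm.antidiagonal 3).over K) γ u = u)
    (hfix : {v : {M : Submodule 𝒪[K] (Fin 3 → K) // IsVertex σ ϖ ((StdForm.antidiagonal 3).over K) M} |
      latticeGraphIso σ ϖ ((StdForm.antidiagonal 3).over K) γ v = v}.Finite)
    (c : {M : Submodule 𝒪[K] (Fin 3 → K) // IsVertex σ ϖ ((StdForm.antidiagonal 3).over K) M} → Fin 2)
    (hc0 : ∀ v, c v = 0 ↔ IsSelfDualLattice σ ϖ ((StdForm.antidiagonal 3).over K) v.1) (q : ℕ)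
    (hdeg : ∀ v, ((latticeGraph σ ϖ ((StdForm.antidiagonal 3).over K)).neighborSet v).ncard = (![q ^ 3, q] : Fin 2 → ℕ) (c v) + 1) :
    {x : {M : Submodule 𝒪[K] (Fin 3 → K) // IsVertex σ ϖ ((StdForm.antidiagonal 3).over K) M} |
        (latticeGraph σ ϖ ((StdForm.antidiagonal 3).over K)).dist x (latticeGraphIso σ ϖ ((StdForm.antidiagonal 3).over K) γ x) = 2 ∧ c x = 1}.ncard +
      (Nat.card (fixedBy (↥(unitaryGroupOfForm σ ((StdForm.antidiagonal 3).over K)) ⧸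
          (glInt 3 K).subgroupOf (unitaryGroupOfForm σ ((StdForm.antidiagonal 3).over K))) γ) +
        Nat.card (fixedBy (↥(unitaryGroupOfForm σ ((StdForm.antidiagonal 3).over K)) ⧸
          ((glInt 3 K).map (MulAut.conj g₁).toMonoidHom).subgroupOf (unitaryGroupOfForm σ ((StdForm.antidiagonal 3).over K))) γ)) =
      (q ^ 3 + 1) * Nat.card (fixedBy (↥(unitaryGroupOfForm σ ((StdForm.antidiagonal 3).over K)) ⧸
          (glInt 3 K).subgroupOf (unitaryGroupOfForm σ ((StdForm.antidiagonal 3).over K))) γ) + 1 := by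
  classical
  have hT := isTree_latticeGraph_three_of_unramified hd
  have hloc : ∀ v, ((latticeGraph σ ϖ ((StdForm.antidiagonal 3).over K)).neighborSet v).Finite := fun v =>
    Set.finite_of_ncard_ne_zero (by rw [hdeg v]; exact Nat.succ_ne_zero _)
  haveI : (latticeGraph σ ϖ ((StdForm.antidiagonal 3).over K)).LocallyFinite := fun v => (hloc v).fintype
  have hdeg' : ∀ y, latticeGraphIso σ ϖ ((StdForm.antidiagonal 3).over K) γ y = y →
      (latticeGraph σ ϖ ((StdForm.antidiagonal 3).over K)).degree y = (fun i : Fin 2 => (![q ^ 3, q] : Fin 2 → ℕ) i + 1) (c y) := fun y _ => by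
    rw [TreeDisplacement.degree_eq_ncard_neighborSet, hdeg y]
  have h := ncard_displaced_two_inter_type_add_card_fixed_eq hT (latticeGraphIso σ ϖ ((StdForm.antidiagonal 3).over K) γ) hu hfix c
    (typeFun_ne_of_adj hd hc0) (i := 1) (j := 0) Fin.zero_ne_one.symm (fun i : Fin 2 => (![q ^ 3, q] : Fin 2 → ℕ) i + 1) hdeg'
  rw [card_toFinset_fixed_eq_natCard_fixedBy_add hd g₁ hg₁ γ hfix, card_filter_typeFun_eq_zero_eq_ncard γ hfix c hc0,
    ← natCard_fixedBy_quotient_glInt_eq_ncard_selfDual_fixed hd γ] at h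
  simpa only [Matrix.cons_val_zero] using h

/-- **`N′_hyp + (V_hyp + V_sp) = (q + 1)·V_sp + 1`** on `X₃`: same hypotheses; the number of HYPERSPECIAL (self-dual) vertices displaced by `2` plus the number of fixed
vertices is `(q+1)` times the number of fixed special vertices plus one — ★ GF1 FILE 1 at `(i, j) = (0, 1)` with ★ DICT0 (D0.2) and §1. [cite: Kottwitz1988, §2]
[cite: Serre1980Trees, I.6.1, I.6.4] [cite: Tits1979, §2.4] -/
theorem ncard_displaced_two_selfDual_add_natCard_fixedBy_eq (hd : UnramifiedLocalConjDatum σ ϖ)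
    (g₁ : GL (Fin 3) K) (hg₁ : (g₁ : Matrix (Fin 3) (Fin 3) K) = Matrix.diagonal ![(1 : K), 1, ϖ])
    (γ : ↥(unitaryGroupOfForm σ ((StdForm.antidiagonal 3).over K)))
    {u : {M : Submodule 𝒪[K] (Fin 3 → K) // IsVertex σ ϖ ((StdForm.antidiagonal 3).over K) M}}
    (hu : latticeGraphIso σ ϖ ((StdForm.antidiagonal 3).over K) γ u = u)
    (hfix : {v : {M : Submodule 𝒪[K] (Fin 3 → K) // IsVertex σ ϖ ((StdForm.antidiagonal 3).over K) M} |
      latticeGraphIso σ ϖ ((StdForm.antidiagonal 3).over K) γ v = v}.Finite)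
    (c : {M : Submodule 𝒪[K] (Fin 3 → K) // IsVertex σ ϖ ((StdForm.antidiagonal 3).over K) M} → Fin 2)
    (hc0 : ∀ v, c v = 0 ↔ IsSelfDualLattice σ ϖ ((StdForm.antidiagonal 3).over K) v.1) (q : ℕ)
    (hdeg : ∀ v, ((latticeGraph σ ϖ ((StdForm.antidiagonal 3).over K)).neighborSet v).ncard = (![q ^ 3, q] : Fin 2 → ℕ) (c v) + 1) :
    {x : {M : Submodule 𝒪[K] (Fin 3 → K) // IsVertex σ ϖ ((StdForm.antidiagonal 3).over K) M} |
        (latticeGraph σ ϖ ((StdForm.antidiagonal 3).over K)).dist x (latticeGraphIso σ ϖ ((StdForm.antidiagonal 3).over K) γ x) = 2 ∧ c x = 0}.ncard +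
      (Nat.card (fixedBy (↥(unitaryGroupOfForm σ ((StdForm.antidiagonal 3).over K)) ⧸
          (glInt 3 K).subgroupOf (unitaryGroupOfForm σ ((StdForm.antidiagonal 3).over K))) γ) +
        Nat.card (fixedBy (↥(unitaryGroupOfForm σ ((StdForm.antidiagonal 3).over K)) ⧸
          ((glInt 3 K).map (MulAut.conj g₁).toMonoidHom).subgroupOf (unitaryGroupOfForm σ ((StdForm.antidiagonal 3).over K))) γ)) =
      (q + 1) * Nat.card (fixedBy (↥(unitaryGroupOfForm σ ((StdForm.antidiagonal 3).over K)) ⧸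
          ((glInt 3 K).map (MulAut.conj g₁).toMonoidHom).subgroupOf (unitaryGroupOfForm σ ((StdForm.antidiagonal 3).over K))) γ) + 1 := by
  classical
  have hT := isTree_latticeGraph_three_of_unramified hd
  have hloc : ∀ v, ((latticeGraph σ ϖ ((StdForm.antidiagonal 3).over K)).neighborSet v).Finite := fun v =>
    Set.finite_of_ncard_ne_zero (by rw [hdeg v]; exact Nat.succ_ne_zero _)
  haveI : (latticeGraph σ ϖ ((StdForm.antidiagonal 3).over K)).LocallyFinite := fun v => (hloc v).fintype
  have hdeg' : ∀ y, latticeGraphIso σ ϖ ((StdForm.antidiagonal 3).over K) γ y = y →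
      (latticeGraph σ ϖ ((StdForm.antidiagonal 3).over K)).degree y = (fun i : Fin 2 => (![q ^ 3, q] : Fin 2 → ℕ) i + 1) (c y) := fun y _ => by
    rw [TreeDisplacement.degree_eq_ncard_neighborSet, hdeg y]
  have h := ncard_displaced_two_inter_type_add_card_fixed_eq hT (latticeGraphIso σ ϖ ((StdForm.antidiagonal 3).over K) γ) hu hfix c
    (typeFun_ne_of_adj hd hc0) (i := 0) (j := 1) Fin.zero_ne_one (fun i : Fin 2 => (![q ^ 3, q] : Fin 2 → ℕ) i + 1) hdeg'
  rw [card_toFinset_fixed_eq_natCard_fixedBy_add hd g₁ hg₁ γ hfix, card_filter_typeFun_eq_one_eq_ncard hd γ hfix c hc0,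
    ← natCard_fixedBy_quotient_conj_glInt_eq_ncard_typeTwo_fixed hd g₁ hg₁ γ] at h
  simpa only [Matrix.cons_val_one, Matrix.head_cons, Matrix.cons_val_zero] using h

/-! ## §3 The assembly shell — coset letters only (★ T2's binders + the two value letters) -/

/-- **THE FIRST DISPLACEMENT SHELLS OF `X₃` FROM `(V_hyp, V_sp)` — the socket GF1 FILE 2b plugs per Flicker literal.**  Under ★ T2's residual letters
(`hσO σk hσk hq hfrob`: `|𝓀| = q²`, `σ` reduces to the `q`-Frobenius) and finiteness letters (`Fix_γ(U ⧸ K₀)` a `Fintype`, `hK₁fin`, `horb`), for any type function `c` and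
any values `V₀ = #Fix_γ(U ⧸ K₀)`, `V₁ = #Fix_γ(U ⧸ K₁)`:
`#{x : d(x, γx) = 2 ∧ c x = 1} + (V₀ + V₁) = (q³+1)·V₀ + 1` and `#{x : d(x, γx) = 2 ∧ c x = 0} + (V₀ + V₁) = (q+1)·V₁ + 1`.
No tree letter is left: the fixed vertex comes from ★ `exists_latticeGraphIso_apply_eq_self_three` (`horb`), the finiteness of `Fix_γ(X₃)` from §1, the bi-regularity from ★ V4
`ncard_neighborSet_eq_typeFun`. [cite: Kottwitz1988, §2] [cite: Serre1980Trees, I.6.1, I.6.4, II.1.1] [cite: Tits1979, §2.4] [cite: Rogawski1990, §4.9] -/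
theorem ncard_displaced_two_add_eq_of_natCard_fixedBy_eq (hd : UnramifiedLocalConjDatum σ ϖ) (hσO : ∀ x : 𝒪[K], σ x ∈ 𝒪[K]) (σk : 𝓀[K] →+* 𝓀[K])
    (hσk : ∀ x : 𝒪[K], IsLocalRing.residue 𝒪[K] ⟨σ x, hσO x⟩ = σk (IsLocalRing.residue 𝒪[K] x))
    [Fintype 𝓀[K]] {q : ℕ} (hq : Fintype.card 𝓀[K] = q ^ 2) (hfrob : ∀ y, σk y = y ^ q)
    (g₁ : GL (Fin 3) K) (hg₁ : (g₁ : Matrix (Fin 3) (Fin 3) K) = Matrix.diagonal ![(1 : K), 1, ϖ])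
    (γ : ↥(unitaryGroupOfForm σ ((StdForm.antidiagonal 3).over K)))
    [Fintype (fixedBy (↥(unitaryGroupOfForm σ ((StdForm.antidiagonal 3).over K)) ⧸
      (glInt 3 K).subgroupOf (unitaryGroupOfForm σ ((StdForm.antidiagonal 3).over K))) γ)]
    (hK₁fin : (fixedBy (↥(unitaryGroupOfForm σ ((StdForm.antidiagonal 3).over K)) ⧸
      ((glInt 3 K).map (MulAut.conj g₁).toMonoidHom).subgroupOf (unitaryGroupOfForm σ ((StdForm.antidiagonal 3).over K))) γ).Finite)
    (horb : (Set.range fun n : ℕ => ((γ ^ n : ↥(unitaryGroupOfForm σ ((StdForm.antidiagonal 3).over K))) :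
      ↥(unitaryGroupOfForm σ ((StdForm.antidiagonal 3).over K)) ⧸ (glInt 3 K).subgroupOf (unitaryGroupOfForm σ ((StdForm.antidiagonal 3).over K)))).Finite)
    (c : {M : Submodule 𝒪[K] (Fin 3 → K) // IsVertex σ ϖ ((StdForm.antidiagonal 3).over K) M} → Fin 2)
    (hc0 : ∀ v, c v = 0 ↔ IsSelfDualLattice σ ϖ ((StdForm.antidiagonal 3).over K) v.1) {V₀ V₁ : ℕ}
    (hV₀ : Nat.card (fixedBy (↥(unitaryGroupOfForm σ ((StdForm.antidiagonal 3).over K)) ⧸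
      (glInt 3 K).subgroupOf (unitaryGroupOfForm σ ((StdForm.antidiagonal 3).over K))) γ) = V₀)
    (hV₁ : Nat.card (fixedBy (↥(unitaryGroupOfForm σ ((StdForm.antidiagonal 3).over K)) ⧸
      ((glInt 3 K).map (MulAut.conj g₁).toMonoidHom).subgroupOf (unitaryGroupOfForm σ ((StdForm.antidiagonal 3).over K))) γ) = V₁) :
    {x : {M : Submodule 𝒪[K] (Fin 3 → K) // IsVertex σ ϖ ((StdForm.antidiagonal 3).over K) M} |
          (latticeGraph σ ϖ ((StdForm.antidiagonal 3).over K)).dist x (latticeGraphIso σ ϖ ((StdForm.antidiagonal 3).over K) γ x) = 2 ∧ c x = 1}.ncard +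
        (V₀ + V₁) = (q ^ 3 + 1) * V₀ + 1 ∧
      {x : {M : Submodule 𝒪[K] (Fin 3 → K) // IsVertex σ ϖ ((StdForm.antidiagonal 3).over K) M} |
          (latticeGraph σ ϖ ((StdForm.antidiagonal 3).over K)).dist x (latticeGraphIso σ ϖ ((StdForm.antidiagonal 3).over K) γ x) = 2 ∧ c x = 0}.ncard +
        (V₀ + V₁) = (q + 1) * V₁ + 1 := by
  subst hV₀ hV₁
  have hfix := finite_fixed_vertices_of_finite_fixedBy hd g₁ hg₁ γ (Set.toFinite _) hK₁fin
  obtain ⟨u, hu⟩ := exists_latticeGraphIso_apply_eq_self_three hd γ horb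
  have hdeg := ncard_neighborSet_eq_typeFun hd hσO σk hσk hq hfrob hc0
  exact ⟨ncard_displaced_two_typeTwo_add_natCard_fixedBy_eq hd g₁ hg₁ γ hu hfix c hc0 q hdeg,
    ncard_displaced_two_selfDual_add_natCard_fixedBy_eq hd g₁ hg₁ γ hu hfix c hc0 q hdeg⟩

/-! ## §4 All hyperspecial displacement shells from `(V_hyp, V_sp)` -/

/-- **EVERY HYPERSPECIAL SHELL FROM `(V_hyp, V_sp)`**: under the letters of §3, for `k ≥ 1`,
`S′_k + q^{2(k−1)}·(V₀ + V₁) = q^{2(k−1)}·((q+1)·V₁ + 1)` if `k` is odd and `S′_k + q^{2k−3}·(V₀ + V₁) = q^{2k−3}·((q³+1)·V₀ + 1)` if `k` is even, where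
`S′_k = #{x self-dual : d(x, γx) = 2k}` is the shell ★ A1's orbital integral `O_γ(1_{K₀ t^k K₀})` counts — ★ G3-NUMBERS `ncard_selfDual_displaced_eq_pow_mul_firstShell_three` ∘ §3.
[cite: Rogawski1990, §4.9 pp. 54–55] [cite: Serre1980Trees, I.6.4 Prop. 24] [cite: Kottwitz1988, §2] [cite: Tits1979, §2.4] -/
theorem ncard_selfDual_displaced_add_eq_of_natCard_fixedBy_eq (hd : UnramifiedLocalConjDatum σ ϖ) (hσO : ∀ x : 𝒪[K], σ x ∈ 𝒪[K]) (σk : 𝓀[K] →+* 𝓀[K])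
    (hσk : ∀ x : 𝒪[K], IsLocalRing.residue 𝒪[K] ⟨σ x, hσO x⟩ = σk (IsLocalRing.residue 𝒪[K] x))
    [Fintype 𝓀[K]] {q : ℕ} (hq : Fintype.card 𝓀[K] = q ^ 2) (hfrob : ∀ y, σk y = y ^ q)
    (g₁ : GL (Fin 3) K) (hg₁ : (g₁ : Matrix (Fin 3) (Fin 3) K) = Matrix.diagonal ![(1 : K), 1, ϖ])
    (γ : ↥(unitaryGroupOfForm σ ((StdForm.antidiagonal 3).over K)))
    [Fintype (fixedBy (↥(unitaryGroupOfForm σ ((StdForm.antidiagonal 3).over K)) ⧸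
      (glInt 3 K).subgroupOf (unitaryGroupOfForm σ ((StdForm.antidiagonal 3).over K))) γ)]
    (hK₁fin : (fixedBy (↥(unitaryGroupOfForm σ ((StdForm.antidiagonal 3).over K)) ⧸
      ((glInt 3 K).map (MulAut.conj g₁).toMonoidHom).subgroupOf (unitaryGroupOfForm σ ((StdForm.antidiagonal 3).over K))) γ).Finite)
    (horb : (Set.range fun n : ℕ => ((γ ^ n : ↥(unitaryGroupOfForm σ ((StdForm.antidiagonal 3).over K))) :
      ↥(unitaryGroupOfForm σ ((StdForm.antidiagonal 3).over K)) ⧸ (glInt 3 K).subgroupOf (unitaryGroupOfForm σ ((StdForm.antidiagonal 3).over K)))).Finite)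
    {V₀ V₁ : ℕ}
    (hV₀ : Nat.card (fixedBy (↥(unitaryGroupOfForm σ ((StdForm.antidiagonal 3).over K)) ⧸
      (glInt 3 K).subgroupOf (unitaryGroupOfForm σ ((StdForm.antidiagonal 3).over K))) γ) = V₀)
    (hV₁ : Nat.card (fixedBy (↥(unitaryGroupOfForm σ ((StdForm.antidiagonal 3).over K)) ⧸
      ((glInt 3 K).map (MulAut.conj g₁).toMonoidHom).subgroupOf (unitaryGroupOfForm σ ((StdForm.antidiagonal 3).over K))) γ) = V₁)
    (k : ℕ) (hk : 1 ≤ k) :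
    {x : {M : Submodule 𝒪[K] (Fin 3 → K) // IsVertex σ ϖ ((StdForm.antidiagonal 3).over K) M} |
          IsSelfDualLattice σ ϖ ((StdForm.antidiagonal 3).over K) x.1 ∧
            (latticeGraph σ ϖ ((StdForm.antidiagonal 3).over K)).dist x
              (latticeGraphPerm σ ϖ ((StdForm.antidiagonal 3).over K) γ x) = 2 * k}.ncard +
        (if Even k then q ^ (2 * k - 3) else q ^ (2 * (k - 1))) * (V₀ + V₁) =
      if Even k then q ^ (2 * k - 3) * ((q ^ 3 + 1) * V₀ + 1) else q ^ (2 * (k - 1)) * ((q + 1) * V₁ + 1) := by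
  classical
  obtain ⟨c, hc0⟩ := exists_typeFun (K := K) (σ := σ) (ϖ := ϖ)
  obtain ⟨h1, h0⟩ := ncard_displaced_two_add_eq_of_natCard_fixedBy_eq hd hσO σk hσk hq hfrob g₁ hg₁ γ hK₁fin horb c hc0 hV₀ hV₁
  have hfix := finite_fixed_vertices_of_finite_fixedBy hd g₁ hg₁ γ (Set.toFinite _) hK₁fin
  obtain ⟨u, hu⟩ := exists_latticeGraphIso_apply_eq_self_three hd γ horb
  have hdeg := ncard_neighborSet_eq_typeFun hd hσO σk hσk hq hfrob hc0
  have hloc : ∀ v, ((latticeGraph σ ϖ ((StdForm.antidiagonal 3).over K)).neighborSet v).Finite := fun v =>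
    Set.finite_of_ncard_ne_zero (by rw [hdeg v]; exact Nat.succ_ne_zero _)
  rw [ncard_selfDual_displaced_eq_pow_mul_firstShell_three hd γ hloc hu hfix c hc0 q (fun v _ => hdeg v) k hk]
  split_ifs with he
  · rw [← mul_add, h1]
  · rw [← mul_add, h0]

end Cosets

end Summit.HodgeConjecture.HodgeConjecture.R90.S6
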